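import Mathlib

/-!
# `Balaban1983to89.B12Rep526` — [Balaban1987RG1] §5 pp. 294–295: the representation (5.26) in GENERAL dimension
`d`, with (5.22)/(5.25), «(5.19) is implied by the form of (5.26)», (5.27) ⇒ (5.18) and (5.28) ⇒ (5.20) PROVED

HONEST FRAMING (cell `lit-balaban`, verbatim): statement-level skeleton of published theorems with citation tags; proofs where landed; nothing here is a claim about the Yang–Mills mass gap.

CITATION HEADER.  T. Bałaban, *Renormalization group approach to lattice gauge field theories. I. Generation of
effective actions in a small field approximation and a coupling constant renormalization in four dimensions*,
Commun. Math. Phys. **109** (1987) 249–301, doi:10.1007/bf01215223 [Balaban1987RG1] (cell paper B12; held text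
`paper:balaban1987-cmp109-rg-i-small-field`, journal page = PDF page + 248; the displays (5.17)–(5.29) were read
from the page renders `b2b-balaban-ref1/pages/1987-cmp109-rg-I-small-field/…-p046-x2.png` (p. 294) and
`…-p047-x2.png` (p. 295)).  Unit `lit-balaban-r09` gen 2 (Phase 2, PHASE2-TARGETS §G seat p11), SKELETON rows
`B12.Eq5.22-5.26` and `B12.Eq5.27-5.29`.  Pre-existing carrier at the same loci (named, not re-declared):
`B12Sec5Algebra` = the case `d = 4` UNROLLED over the 16 sign vectors for the index pairs (1,1), (1,2), (2,1) over
real variables (`F11`, `F12`, `F21`, the flips `F11_flip*`/`F12_flip*` = instances of (5.19), `f12_eq_f21_inv` =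
(5.28) ⇒ (5.20)), with the later algebra (5.30)–(5.41); this module is the general-`d`, all-index-pairs, any-field
form of the representation itself and of the three equivalences stated on p. 295, which `B12Sec5Algebra` does not
have.

WHAT IS PRINTED (verbatim).  p. 294: *«f_{μν}(rz) = ((r⊗r)f)_{μν}(z) if r is a permutation, (5.18)
f_{μν}(z^ε) = ε_με_ν z_μ^{−(1−ε_μ)/2} z_ν^{(1−ε_ν)/2} f_{μν}(z), (5.19)  f_{μν}(z) = f_{νμ}(z⁻¹), (5.20)»*;
*«Applying the above representations to all variables we obtain f_{μν}(z) = Σ_ε g^ε_{μν}(z^ε), (5.22) where the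
functions g^ε_{μν}(z) are analytic on the polydisc …»*.  p. 295: *«These normalization conditions and the
transformation laws (5.19) imply the equalities g^ε_{μν}(z) = ε_με_ν z_μ^{−(1−ε_μ)/2} z_ν^{(1−ε_ν)/2} g^{(+1,…,+1)}_{μν}(z). (5.25)
Denoting g_{μν}(z) = g^{(+1,…,+1)}_{μν}(z), we get the following representation:
    f_{μν}(z) = Σ_ε ε_με_ν z_μ^{(1−ε_μ)/2} z_ν^{−(1−ε_ν)/2} g_{μν}(z^ε).   (5.26)
Let us now write properties of the functions g_{μν}(z) equivalent to the properties (5.18)–(5.20). The equalities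
(5.18) are equivalent to g_{μν}(rz) = ((r⊗r)g)_{μν}(z) if r is a permutation. (5.27)  The equalities (5.19) are
implied by the form of the representation (5.26). The equalities (5.20) are equivalent to
g_{μν}(z) = z_ν⁻¹ z_μ g_{νμ}(z). (5.28)  From the definition of the function f_{μν}(z), we have also the following
representation: f_{μν}(z) = Σ_{x∈ℤ^d} z^{−x} Π_{μν}(x), (5.29) hence the terms of the representation (5.22) are
obtained by restricting correspondingly the range of the summation in (5.29). This implies that all these terms, and
in particular the function g_{μν}(z), are real functions for real variables z.»*

WHAT THIS MODULE TYPES AND PROVES (over any field `K`; `d` arbitrary; sign vectors `ε : Fin d → ℤˣ`;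
`z^ε = (z_κ^{ε_κ})_κ`; the permutation `r` acts by `(rz)_μ = z_{r⁻¹μ}`, `((r⊗r)f)_{μν} = f_{r⁻¹μ, r⁻¹ν}` — the
permutation-matrix reading of (5.31)).
* `rep526 g μ ν z` — the right member of (5.26) for a family `g = (g_{μν})`; `gEps` — (5.25); `eq522` — (5.22)
  holds with the `g^ε` of (5.25) (definitional unfolding of (5.26)).
* `eq519_of_rep526` — **«The equalities (5.19) are implied by the form of the representation (5.26)»**: PROVED for
  all `ε`, all `μ, ν` (also `μ = ν`), at every point of the polyring (`z_κ ≠ 0`).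
* `eq518_of_eq527` — **(5.27) ⇒ (5.18)**, PROVED (re-indexing `ε ↦ ε∘r`).
* `eq520_of_eq528` — **(5.28) ⇒ (5.20)**, PROVED (re-indexing `ε ↦ −ε`).
NOT typed here: the converse implications «equivalent» (they rest on the UNIQUENESS of the Laurent decomposition
(5.22) under the normalizations (5.23)–(5.24), i.e. on the analytic content of row `B12.Eq5.22-5.26`, not on the
algebraic form), and (5.29) (reality from the Laurent coefficients `Π_{μν}(x)`) for the same reason.  Nothing of
the series is asserted; no `Prop` fact; every theorem is kernel-checked finite algebra.
-/

namespace Literature.MathematicalPhysics.QuantumFieldTheory.Balaban1983to89.B12Rep526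

open Finset

variable {K : Type*} [Field K] {d : ℕ}

/-! ## 1. Sign vectors, `z^ε`, and the prefactor of (5.26) -/

/-- The sign `ε_κ ∈ {±1}` as a scalar. [cite: Balaban1987RG1, (5.19) p.294] -/
def sgn (e : ℤˣ) : K := ((e : ℤ) : K)

/-- `z_κ^{(1−ε_κ)/2}`: `1` for `ε_κ = +1`, `z_κ` for `ε_κ = −1`. [cite: Balaban1987RG1, (5.26) p.295] -/
def low (e : ℤˣ) (t : K) : K := if e = 1 then 1 else t

/-- `z^ε = (z_κ^{ε_κ})_κ` (p. 294: «z^ε denote the vector {z_μ^{ε_μ}}»). [cite: Balaban1987RG1, (5.19) p.294] -/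
def twist (ε : Fin d → ℤˣ) (z : Fin d → K) : Fin d → K := fun κ => z κ ^ ((ε κ : ℤ))

/-- The action of a permutation `r` of the indices on the variables: `(rz)_μ = z_{r⁻¹ μ}` (so that coordinate `μ` of
`z` becomes coordinate `r μ` of `rz`). [cite: Balaban1987RG1, (5.18) p.294] -/
def permZ (r : Equiv.Perm (Fin d)) (z : Fin d → K) : Fin d → K := fun μ => z (r.symm μ)

omit [Field K] in
/-- `permZ` evaluated. [cite: Balaban1987RG1, (5.18) p.294] -/
@[simp] theorem permZ_apply (r : Equiv.Perm (Fin d)) (z : Fin d → K) (μ : Fin d) : permZ r z μ = z (r.symm μ) := rfl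

/-- `sgn 1 = 1`. [cite: Balaban1987RG1, (5.19) p.294] -/
@[simp] theorem sgn_one : (sgn 1 : K) = 1 := by simp [sgn]

/-- `sgn (−e) = −sgn e`. [cite: Balaban1987RG1, (5.19) p.294] -/
@[simp] theorem sgn_neg (e : ℤˣ) : (sgn (-e) : K) = -sgn e := by simp [sgn]

/-- `sgn (e e′) = sgn e · sgn e′`. [cite: Balaban1987RG1, (5.19) p.294] -/
@[simp] theorem sgn_mul (e e' : ℤˣ) : (sgn (e * e') : K) = sgn e * sgn e' := by simp [sgn]

/-- `sgn e · sgn e = 1`. [cite: Balaban1987RG1, (5.19) p.294] -/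
@[simp] theorem sgn_mul_self (e : ℤˣ) : (sgn e : K) * sgn e = 1 := by
  rw [← sgn_mul, Int.units_mul_self, sgn_one]

/-- `low 1 t = 1`. [cite: Balaban1987RG1, (5.26) p.295] -/
@[simp] theorem low_one (t : K) : low 1 t = 1 := by simp [low]

/-- `low (−1) t = t`. [cite: Balaban1987RG1, (5.26) p.295] -/
@[simp] theorem low_neg_one (t : K) : low (-1) t = t := by simp [low]

/-- `(z^{ε′})^{ε} = z^{ε ε′}` (`ε_κ, ε′_κ ∈ {±1}`). [cite: Balaban1987RG1, (5.19) p.294] -/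
theorem twist_twist (ε ε' : Fin d → ℤˣ) (z : Fin d → K) : twist ε (twist ε' z) = twist (ε * ε') z := by
  funext κ
  simp only [twist, Pi.mul_apply, Units.val_mul]
  rw [← zpow_mul, mul_comm]

/-- `z^{(+1,…,+1)} = z`. [cite: Balaban1987RG1, (5.19) p.294] -/
@[simp] theorem twist_one (z : Fin d → K) : twist 1 z = z := by
  funext κ; simp [twist]

/-- `z^{(−1,…,−1)} = z⁻¹`. [cite: Balaban1987RG1, (5.20) p.294] -/
@[simp] theorem twist_neg_one (z : Fin d → K) : twist (-1) z = fun κ => (z κ)⁻¹ := by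
  funext κ; simp [twist]

/-- `(rz)^ε = r(z^{ε∘r})`, where `(ε∘r)_λ = ε_{rλ}`. [cite: Balaban1987RG1, (5.18) p.294] -/
theorem twist_permZ (ε : Fin d → ℤˣ) (r : Equiv.Perm (Fin d)) (z : Fin d → K) :
    twist ε (permZ r z) = permZ r (twist (ε ∘ r) z) := by
  funext κ; simp [twist, permZ]

/-! ## 2. The representation (5.26), and (5.22) with the `g^ε` of (5.25) -/

/-- **The right member of (5.26)** for a family `g = (g_{μν})_{μν}` of functions of `d` variables:
`Σ_ε ε_με_ν z_μ^{(1−ε_μ)/2} z_ν^{−(1−ε_ν)/2} g_{μν}(z^ε)` (sum over all `2^d` sign vectors; for `μ = ν` the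
prefactor is `1` on the polyring). [cite: Balaban1987RG1, (5.26) p.295] -/
def rep526 (g : Fin d → Fin d → (Fin d → K) → K) (μ ν : Fin d) (z : Fin d → K) : K :=
  ∑ ε : Fin d → ℤˣ, sgn (ε μ) * sgn (ε ν) * low (ε μ) (z μ) * (low (ε ν) (z ν))⁻¹ * g μ ν (twist ε z)

/-- (5.25): the functions `g^ε_{μν}(z) = ε_με_ν z_μ^{−(1−ε_μ)/2} z_ν^{(1−ε_ν)/2} g_{μν}(z)` in terms of
`g_{μν} = g^{(+1,…,+1)}_{μν}`. [cite: Balaban1987RG1, (5.25) p.295] -/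
def gEps (g : Fin d → Fin d → (Fin d → K) → K) (ε : Fin d → ℤˣ) (μ ν : Fin d) (z : Fin d → K) : K :=
  sgn (ε μ) * sgn (ε ν) * (low (ε μ) (z μ))⁻¹ * low (ε ν) (z ν) * g μ ν z

/-- `g^{(+1,…,+1)} = g` ((5.25) at `ε = (+1,…,+1)`: «Denoting g_{μν}(z) = g^{(+1,…,+1)}_{μν}(z)»).
[cite: Balaban1987RG1, (5.25) p.295] -/
@[simp] theorem gEps_one (g : Fin d → Fin d → (Fin d → K) → K) (μ ν : Fin d) (z : Fin d → K) :
    gEps g 1 μ ν z = g μ ν z := by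
  simp [gEps]

/-- One coordinate of (5.25) evaluated at `z^ε`: `(low ε_κ (z_κ^{ε_κ}))⁻¹ = …` — for `ε_κ = −1` and `z_κ ≠ 0`,
`((z_κ⁻¹))⁻¹ = z_κ`; packaged as the identity between the (5.25)-prefactor at `z^ε` and the (5.26)-prefactor at `z`.
[cite: Balaban1987RG1, (5.25) p.295] -/
theorem low_twist_inv (e : ℤˣ) (t : K) : (low e (t ^ ((e : ℤ))))⁻¹ = low e t ∧
    low e (t ^ ((e : ℤ))) = (low e t)⁻¹ := by
  rcases Int.units_eq_one_or e with rfl | rfl <;> simp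

/-- **(5.22) with the `g^ε` of (5.25)**: `f_{μν}(z) = Σ_ε g^ε_{μν}(z^ε)` equals the right member of (5.26), at every
point (with the convention `0⁻¹ = 0` even off the polyring). [cite: Balaban1987RG1, (5.22) p.294] -/
theorem eq522 (g : Fin d → Fin d → (Fin d → K) → K) (μ ν : Fin d) (z : Fin d → K) :
    ∑ ε : Fin d → ℤˣ, gEps g ε μ ν (twist ε z) = rep526 g μ ν z := by
  unfold rep526 gEps
  refine Finset.sum_congr rfl fun ε _ => ?_
  have hμ : (low (ε μ) (twist ε z μ))⁻¹ = low (ε μ) (z μ) := (low_twist_inv (ε μ) (z μ)).1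
  have hν : low (ε ν) (twist ε z ν) = (low (ε ν) (z ν))⁻¹ := (low_twist_inv (ε ν) (z ν)).2
  rw [hμ, hν]

/-! ## 3. «The equalities (5.19) are implied by the form of the representation (5.26)» -/

/-- Per-coordinate bookkeeping for (5.19), the `μ`-factor: for `e, e′ ∈ {±1}`, `t ≠ 0`,
`sgn(ee′)·low(ee′, t^{e′}) = [sgn e′ · (low e′ t)⁻¹] · [sgn e · low e t]`. [cite: Balaban1987RG1, (5.19) p.294] -/
theorem key_mu (e e' : ℤˣ) {t : K} (ht : t ≠ 0) :
    (sgn (e * e') : K) * low (e * e') (t ^ ((e' : ℤ))) = sgn e' * (low e' t)⁻¹ * (sgn e * low e t) := by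
  rcases Int.units_eq_one_or e with rfl | rfl <;> rcases Int.units_eq_one_or e' with rfl | rfl <;>
    simp [sgn, low, ht]

/-- Per-coordinate bookkeeping for (5.19), the `ν`-factor: for `e, e′ ∈ {±1}`, `t ≠ 0`,
`sgn(ee′)·(low(ee′, t^{e′}))⁻¹ = [sgn e′ · low e′ t] · [sgn e · (low e t)⁻¹]`. [cite: Balaban1987RG1, (5.19) p.294] -/
theorem key_nu (e e' : ℤˣ) {t : K} (ht : t ≠ 0) :
    (sgn (e * e') : K) * (low (e * e') (t ^ ((e' : ℤ))))⁻¹ = sgn e' * low e' t * (sgn e * (low e t)⁻¹) := by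
  rcases Int.units_eq_one_or e with rfl | rfl <;> rcases Int.units_eq_one_or e' with rfl | rfl <;>
    simp [sgn, low, ht]

/-- **(5.19) from the form of (5.26)** (p. 295: «The equalities (5.19) are implied by the form of the
representation (5.26)»): for EVERY family `g`, the function `f_{μν} := ` right member of (5.26) satisfies
`f_{μν}(z^ε) = ε_με_ν z_μ^{−(1−ε_μ)/2} z_ν^{(1−ε_ν)/2} f_{μν}(z)` for all sign vectors `ε`, all `μ, ν`, at every
point of the polyring.  PROVED (substitute `ε″ = ε′ε` in the sum, `(z^ε)^{ε′} = z^{ε′ε}`).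
[cite: Balaban1987RG1, (5.19) p.294] -/
theorem eq519_of_rep526 (g : Fin d → Fin d → (Fin d → K) → K) (μ ν : Fin d) (ε : Fin d → ℤˣ)
    {z : Fin d → K} (hz : ∀ κ, z κ ≠ 0) :
    rep526 g μ ν (twist ε z) =
      sgn (ε μ) * sgn (ε ν) * (low (ε μ) (z μ))⁻¹ * low (ε ν) (z ν) * rep526 g μ ν z := by
  unfold rep526
  rw [Finset.mul_sum]
  -- re-index: the summand of the left sum at `δ * ε` is the scaled summand of the right sum at `δ`
  refine (Fintype.sum_equiv (Equiv.mulRight ε) _ _ fun δ => ?_).symm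
  simp only [Equiv.coe_mulRight, Pi.mul_apply, twist_twist]
  have hδ : δ * ε * ε = δ := by
    rw [mul_assoc, show ε * ε = 1 from funext fun κ => Int.units_mul_self (ε κ), mul_one]
  rw [hδ]
  have hμ : sgn (δ μ * ε μ) * low (δ μ * ε μ) (twist ε z μ)
      = sgn (ε μ) * (low (ε μ) (z μ))⁻¹ * (sgn (δ μ) * low (δ μ) (z μ)) := key_mu (δ μ) (ε μ) (hz μ)
  have hν : sgn (δ ν * ε ν) * (low (δ ν * ε ν) (twist ε z ν))⁻¹
      = sgn (ε ν) * low (ε ν) (z ν) * (sgn (δ ν) * (low (δ ν) (z ν))⁻¹) := key_nu (δ ν) (ε ν) (hz ν)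
  calc sgn (ε μ) * sgn (ε ν) * (low (ε μ) (z μ))⁻¹ * low (ε ν) (z ν)
        * (sgn (δ μ) * sgn (δ ν) * low (δ μ) (z μ) * (low (δ ν) (z ν))⁻¹ * g μ ν (twist δ z))
      = (sgn (ε μ) * (low (ε μ) (z μ))⁻¹ * (sgn (δ μ) * low (δ μ) (z μ)))
        * (sgn (ε ν) * low (ε ν) (z ν) * (sgn (δ ν) * (low (δ ν) (z ν))⁻¹)) * g μ ν (twist δ z) := by ring
    _ = (sgn (δ μ * ε μ) * low (δ μ * ε μ) (twist ε z μ))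
        * (sgn (δ ν * ε ν) * (low (δ ν * ε ν) (twist ε z ν))⁻¹) * g μ ν (twist δ z) := by rw [hμ, hν]
    _ = sgn (δ μ * ε μ) * sgn (δ ν * ε ν) * low (δ μ * ε μ) (twist ε z μ)
        * (low (δ ν * ε ν) (twist ε z ν))⁻¹ * g μ ν (twist δ z) := by ring

/-! ## 4. (5.27) ⇒ (5.18): permutation covariance -/

/-- **(5.27) ⇒ (5.18)** (p. 295: «The equalities (5.18) are equivalent to g_{μν}(rz) = ((r⊗r)g)_{μν}(z) if r is a
permutation. (5.27)» — the direction used): if the family `g` transforms under the permutation `r` as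
`g_{μν}(rz) = g_{r⁻¹μ, r⁻¹ν}(z)`, then so does `f = ` right member of (5.26).  PROVED (re-index `ε ↦ ε∘r`).
[cite: Balaban1987RG1, (5.27) p.295] -/
theorem eq518_of_eq527 (g : Fin d → Fin d → (Fin d → K) → K) (r : Equiv.Perm (Fin d))
    (h527 : ∀ (μ ν : Fin d) (z : Fin d → K), g μ ν (permZ r z) = g (r.symm μ) (r.symm ν) z)
    (μ ν : Fin d) (z : Fin d → K) :
    rep526 g μ ν (permZ r z) = rep526 g (r.symm μ) (r.symm ν) z := by
  unfold rep526
  -- re-index: the summand of the left sum at `ε` is the summand of the right sum at `ε ∘ r`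
  refine Fintype.sum_equiv (Equiv.arrowCongr r.symm (Equiv.refl ℤˣ)) _ _ fun ε => ?_
  have hε : (Equiv.arrowCongr r.symm (Equiv.refl ℤˣ)) ε = ε ∘ r := by
    funext κ; simp [Equiv.arrowCongr_apply]
  rw [hε, twist_permZ, h527]
  simp [permZ, Function.comp]

/-! ## 5. (5.28) ⇒ (5.20): the reflection law `f_{μν}(z) = f_{νμ}(z⁻¹)` -/

/-- Per-coordinate bookkeeping for (5.20), the `μ`-factor: `low(e,t)·t^e = (low(−e, t⁻¹))⁻¹` (`t ≠ 0`).
[cite: Balaban1987RG1, (5.20) p.294] -/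
theorem key_mu' (e : ℤˣ) {t : K} (ht : t ≠ 0) : low e t * t ^ ((e : ℤ)) = (low (-e) t⁻¹)⁻¹ := by
  rcases Int.units_eq_one_or e with rfl | rfl <;> simp [low, ht]

/-- Per-coordinate bookkeeping for (5.20), the `ν`-factor: `(low(e,t))⁻¹·(t^e)⁻¹ = low(−e, t⁻¹)` (`t ≠ 0`).
[cite: Balaban1987RG1, (5.20) p.294] -/
theorem key_nu' (e : ℤˣ) {t : K} (ht : t ≠ 0) : (low e t)⁻¹ * (t ^ ((e : ℤ)))⁻¹ = low (-e) t⁻¹ := by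
  rcases Int.units_eq_one_or e with rfl | rfl <;> simp [low, ht]

/-- **(5.28) ⇒ (5.20)** (p. 295: «The equalities (5.20) are equivalent to g_{μν}(z) = z_ν⁻¹z_μ g_{νμ}(z). (5.28)» —
the direction used): if `g_{μν}(w) = w_ν⁻¹ w_μ g_{νμ}(w)` on the polyring, then `f_{μν}(z) = f_{νμ}(z⁻¹)` for
`f = ` right member of (5.26), at every point of the polyring.  PROVED (re-index `ε ↦ −ε`, `(z⁻¹)^ε = z^{−ε}`).
[cite: Balaban1987RG1, (5.28) p.295] -/
theorem eq520_of_eq528 (g : Fin d → Fin d → (Fin d → K) → K)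
    (h528 : ∀ (μ ν : Fin d) (w : Fin d → K), (∀ κ, w κ ≠ 0) → g μ ν w = (w ν)⁻¹ * w μ * g ν μ w)
    (μ ν : Fin d) {z : Fin d → K} (hz : ∀ κ, z κ ≠ 0) :
    rep526 g μ ν z = rep526 g ν μ (fun κ => (z κ)⁻¹) := by
  unfold rep526
  -- `z⁻¹ = z^{(−1,…,−1)}`, so `(z⁻¹)^{−ε} = z^{ε}`: the summand of the left sum at `ε` is the summand of the
  -- right sum at `−ε`
  rw [← twist_neg_one z]
  refine Fintype.sum_equiv (Equiv.neg (Fin d → ℤˣ)) _ _ fun ε => ?_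
  have h1 : twist (-ε) (twist (-1) z) = twist ε z := by
    rw [twist_twist]; congr 1; simp
  have h2 : ∀ κ, twist (-1 : Fin d → ℤˣ) z κ = (z κ)⁻¹ := fun κ => by simp [twist]
  rw [show (Equiv.neg (Fin d → ℤˣ)) ε = -ε from rfl, h1, h2 μ, h2 ν]
  simp only [Pi.neg_apply, sgn_neg, neg_mul, mul_neg, neg_neg]
  have htw : ∀ κ, twist ε z κ ≠ 0 := fun κ => zpow_ne_zero _ (hz κ)
  rw [h528 μ ν (twist ε z) htw]
  have hμ : low (ε μ) (z μ) * twist ε z μ = (low (-ε μ) (z μ)⁻¹)⁻¹ := key_mu' (ε μ) (hz μ)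
  have hν : (low (ε ν) (z ν))⁻¹ * (twist ε z ν)⁻¹ = low (-ε ν) (z ν)⁻¹ := key_nu' (ε ν) (hz ν)
  rw [← hν, ← hμ]
  ring

end Literature.MathematicalPhysics.QuantumFieldTheory.Balaban1983to89.B12Rep526
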